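import Literature.Geometry.Kaehler.ComplexTorusIntegralHardLefschetzModN
import Literature.Geometry.Kaehler.ComplexTorusHardLefschetzMinimalClassModPrimeKernel
import Literature.Geometry.Kaehler.ComplexTorusIntegralHardLefschetzMinimalClassDegreeThree
import HarnessLib

/-!
# Integral hard Lefschetz for the minimal classes on ANY presentation of a polarised complex torus (part III):
# the remaining index, exponent, divisibility and mod-`p` statements of g40–g41

Layer `Literature/Geometry/Kaehler`, namespace `Literature.Geometry.Kaehler.ComplexTorus`; lane `lit-hodgefound` (Track 2
foundations library), seat p09, generation 42, row g42-#9. THEOREMS ONLY (0 definitions); no named fact, net debt 0.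

The integral hard-Lefschetz theory of the minimal classes `γ_q = θ^{∧q}/(q!·d₁⋯d_q)` of a polarised complex torus `X = E/Φ(ℤ^ι)` of type
`(d₁, …, d_g)` (g40 `…IntegralCoLefschetzMinimalClassCokernels`, `…IntegralHardLefschetzMinimalClassDegreeTwo/Three`, g41
`…CokernelExponents`, `…IntegralHardLefschetzModN`, `…HardLefschetzMinimalClassModPrimeKernel`) was written for a SYMPLECTIC presentation
(`IsSymplecticEnum Φ e₀ η d`: the lattice basis `Φ` is symplectic for `η`), with "any presentation" (`IsPolarizationType Φ η d`) forms for
its headline statements. This file supplies the any-presentation forms of the REMAINING statements — every one of them concerns only the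
lattices `Hᵏ(X, ℤ) = integralForms Φ k` and the forms `θ = ofRealForm η`, `γ_q`, which depend on the lattice `Φ(ℤ^ι) ⊂ E` alone, so each
follows from its symplectic form by re-presenting the torus on a symplectic basis of the same lattice
(`IsPolarizationType.exists_isSymplecticEnum`, `integralForms_eq_of_range_latticeVec_eq`):

* §1 degree one (`g = j + 2`, `m = γ_{g−1}`): `[H^{2g−1}(X, ℤ) : m ∧ H¹(X, ℤ)] = ∏_x d_g/d_{a(x)} = (∏_a d_g/d_a)²`; for a prime `p`,
  `m ∧ H¹ + p·H^{2g−1} = H^{2g−1} ⟺ p ∤ d_g/d₁`;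
* §2 degree two (`g = j + 2`, `γ = γ_{g−2}`): `g − 1 ∣ [H^{2g−2} : γ ∧ H²]`, `γ ∧ H² ≠ H^{2g−2}` for `g ≥ 3`, the order `(g−1)·d_{g−1}/d₁` of `γ_{g−1}`
  modulo `γ ∧ H²`, `γ ∧ H² + ℤγ_{g−1} = H^{2g−2}` for `g = 2` or a constant type; constant type, `p ∣ g − 1`: `[K_p : p·H²] = p` for the
  mod-`p` kernel `K_p`, `K_p ≠ p·H²`, and `γ ∧ x ∈ p·H^{2g−2} ⟺ x ∈ ℤ·(θ/d₁) + p·H²`;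
* §3 the `H³` side of `γ_{g−2}` (`g = j + 2`): `[H^{2g−1} : γ_{g−2} ∧ H³] = ∏_x d_{g−1}/d_{min(a(x), g−1)}`,
  `(d_{g−1}/d₁)·H^{2g−1} ⊆ γ_{g−2} ∧ H³`, and `γ_{g−2} ∧ H³ + p·H^{2g−1} = H^{2g−1} ⟺ p ∤ d_{g−1}/d₁` (the exponent statements are in g41-#5);
* §4 degree three (`g = j + 3`, `γ = γ_{g−3}`): `(g−2)^{2g} ∣ [H^{2g−3} : γ ∧ H³]` and `γ ∧ H³ ≠ H^{2g−3}` for `g ≥ 4`.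

Sources (the statements being made precise over `ℤ`): Lange 2023 §5.4.1 Thm. 5.4.1 and (5.22) (PDF p. 275: hard Lefschetz; the integral
Lefschetz decomposition holds only up to finite index), §2.5.3 Thm. 2.5.16 / Cor. 2.5.17 (PDF p. 135: `θ^{∧q}` on a symplectic basis), §1.5.1
(PDF p. 51: the type), §4.2 (PDF p. 204); Voisin 2002 §7.1.2 (PDF p. 134 L31: the Lefschetz operator acts on integral cohomology and hard
Lefschetz fails over `ℤ`), §6.2.3 Thm. 6.25 (PDF p. 125); Benoist–Debarre 2023 §1 (p. 3: minimal classes).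

## References

* [cite: Lange2023AbelianVarietiesComplex, §5.4.1 Thm. 5.4.1 and (5.22) (PDF p. 275); §2.5.3 Thm. 2.5.16 and Cor. 2.5.17 (PDF p. 135);
  §1.5.1 (PDF p. 51); §4.2 (PDF p. 204)]
* [cite: VoisinHodgeI2002, §6.2.3 Thm. 6.25 (PDF p. 125); §7.1.2 (PDF p. 134 L31)]
* [cite: BenoistDebarre2023SmoothSubvarietiesJacobians, §1 (p. 3)]
-/

noncomputable section

open Module Function
open Literature.LinearAlgebra.Alternating

namespace Literature.Geometry.Kaehler.ComplexTorus

/-! ## §1 Degree one: `γ_{g−1} ∧ H¹(X, ℤ) ⊆ H^{2g−1}(X, ℤ)` (`g = j + 2`) -/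

section DegreeOne

variable {ι : Type*} [Fintype ι] [DecidableEq ι] {E : Type*} [NormedAddCommGroup E] [NormedSpace ℂ E]
  {Φ : (ι → ℝ) ≃L[ℝ] E} {j : ℕ} {η : E [⋀^Fin 2]→L[ℝ] ℝ} {d : Fin (j + 2) → ℕ}

/-- **Any presentation: `[H^{2g−1}(X, ℤ) : γ_{g−1} ∧ H¹(X, ℤ)] = ∏_{x ∈ {λ₁,…,μ_g}} d_g/d_{a(x)}`** (`g = j + 2`, `m = γ_{g−1}`).
[cite: Lange2023AbelianVarietiesComplex, §5.4.1 Thm. 5.4.1 and (5.22) (PDF p. 275); §1.5.1 (PDF p. 51)] [cite: VoisinHodgeI2002, §7.1.2 (PDF p. 134 L31)] -/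
theorem IsPolarizationType.relIndex_map_wedge_integralForms_one_of_eq_content_smul (hd : IsPolarizationType Φ η d)
    (hη : IsRiemannForm Φ η) (hle₁ : j + 1 ≤ j + 2) {m : E [⋀^Fin (2 * (j + 1))]→L[ℝ] ℂ}
    (hm : wedgePow (ofRealForm η) (j + 1) = (((j + 1).factorial * ∏ i : Fin (j + 1), d (Fin.castLE hle₁ i) : ℕ) : ℂ) • m) :
    ((integralForms Φ 1).map (AddMonoidHom.mk'
        (fun x : E [⋀^Fin 1]→L[ℝ] ℂ ↦ (m.wedge x : E [⋀^Fin (2 * j + 3)]→L[ℝ] ℂ))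
        (ContinuousAlternatingMap.wedge_add_right _))).relIndex (integralForms Φ (2 * j + 3)) =
      ∏ x : Fin (j + 2) ⊕ Fin (j + 2), (d (Fin.last (j + 1)) / d (Sum.elim id id x)) := by
  obtain ⟨Φ', hΛ, hs⟩ := hd.exists_isSymplecticEnum Φ
  rw [integralForms_eq_of_range_latticeVec_eq hΛ.symm 1, integralForms_eq_of_range_latticeVec_eq hΛ.symm (2 * j + 3)]
  exact hs.relIndex_map_wedge_integralForms_one_of_eq_content_smul Φ' (hη.of_range_latticeVec_subset hΛ.le) hle₁ hm

/-- **Any presentation: `[H^{2g−1}(X, ℤ) : γ_{g−1} ∧ H¹(X, ℤ)] = (∏_{a=1}^{g} d_g/d_a)²`** (`g = j + 2`).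
[cite: Lange2023AbelianVarietiesComplex, §5.4.1 (5.22) (PDF p. 275); §1.5.1 (PDF p. 51)] [cite: VoisinHodgeI2002, §7.2.2 (PDF p. 142 L10)] -/
theorem IsPolarizationType.relIndex_map_wedge_integralForms_one_eq_sq_of_eq_content_smul (hd : IsPolarizationType Φ η d)
    (hη : IsRiemannForm Φ η) (hle₁ : j + 1 ≤ j + 2) {m : E [⋀^Fin (2 * (j + 1))]→L[ℝ] ℂ}
    (hm : wedgePow (ofRealForm η) (j + 1) = (((j + 1).factorial * ∏ i : Fin (j + 1), d (Fin.castLE hle₁ i) : ℕ) : ℂ) • m) :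
    ((integralForms Φ 1).map (AddMonoidHom.mk'
        (fun x : E [⋀^Fin 1]→L[ℝ] ℂ ↦ (m.wedge x : E [⋀^Fin (2 * j + 3)]→L[ℝ] ℂ))
        (ContinuousAlternatingMap.wedge_add_right _))).relIndex (integralForms Φ (2 * j + 3)) =
      (∏ a : Fin (j + 2), (d (Fin.last (j + 1)) / d a)) ^ 2 := by
  obtain ⟨Φ', hΛ, hs⟩ := hd.exists_isSymplecticEnum Φ
  rw [integralForms_eq_of_range_latticeVec_eq hΛ.symm 1, integralForms_eq_of_range_latticeVec_eq hΛ.symm (2 * j + 3)]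
  exact hs.relIndex_map_wedge_integralForms_one_eq_sq_of_eq_content_smul Φ' (hη.of_range_latticeVec_subset hΛ.le) hle₁ hm

/-- **Any presentation, `p` prime: `γ_{g−1} ∧ H¹(X, ℤ) + p·H^{2g−1}(X, ℤ) = H^{2g−1}(X, ℤ) ⟺ p ∤ d_g/d₁`** (`g = j + 2`) — the minimal class
`∪ (−)` is onto `H^{2g−1}(X, ℤ/p)` iff `p` does not divide the exponent `d_g/d₁` of the cokernel.
[cite: Lange2023AbelianVarietiesComplex, §5.4.1 (5.22) (PDF p. 275); §1.5.1 (PDF p. 51)] [cite: VoisinHodgeI2002, §7.1.2 (PDF p. 134 L31)] -/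
theorem IsPolarizationType.map_wedge_integralForms_one_sup_map_nsmul_eq_iff_not_dvd_of_eq_content_smul (hd : IsPolarizationType Φ η d)
    (hη : IsRiemannForm Φ η) (hle₁ : j + 1 ≤ j + 2) {m : E [⋀^Fin (2 * (j + 1))]→L[ℝ] ℂ}
    (hm : wedgePow (ofRealForm η) (j + 1) = (((j + 1).factorial * ∏ i : Fin (j + 1), d (Fin.castLE hle₁ i) : ℕ) : ℂ) • m)
    {p : ℕ} (hp : p.Prime) :
    (integralForms Φ 1).map (AddMonoidHom.mk'
        (fun x : E [⋀^Fin 1]→L[ℝ] ℂ ↦ (m.wedge x : E [⋀^Fin (2 * j + 3)]→L[ℝ] ℂ)) (ContinuousAlternatingMap.wedge_add_right _)) ⊔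
      (integralForms Φ (2 * j + 3)).map (nsmulAddMonoidHom p) = integralForms Φ (2 * j + 3) ↔
      ¬p ∣ d (Fin.last (j + 1)) / d 0 := by
  obtain ⟨Φ', hΛ, hs⟩ := hd.exists_isSymplecticEnum Φ
  rw [integralForms_eq_of_range_latticeVec_eq hΛ.symm 1, integralForms_eq_of_range_latticeVec_eq hΛ.symm (2 * j + 3)]
  exact hs.map_wedge_integralForms_one_sup_map_nsmul_eq_iff_not_dvd_of_eq_content_smul Φ' (hη.of_range_latticeVec_subset hΛ.le) hle₁ hm hp

end DegreeOne

/-! ## §2 Degree two: `γ_{g−2} ∧ H²(X, ℤ) ⊆ H^{2g−2}(X, ℤ)` (`g = j + 2`) -/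

section DegreeTwo

variable {ι : Type*} [Fintype ι] [DecidableEq ι] {E : Type*} [NormedAddCommGroup E] [NormedSpace ℂ E]
  {Φ : (ι → ℝ) ≃L[ℝ] E} {j : ℕ} {η : E [⋀^Fin 2]→L[ℝ] ℝ} {d : Fin (j + 2) → ℕ}

/-- **Any presentation: `g − 1 ∣ [H^{2g−2}(X, ℤ) : γ_{g−2} ∧ H²(X, ℤ)]`** (`g = j + 2`).
[cite: Lange2023AbelianVarietiesComplex, §5.4.1 (5.22) (PDF p. 275); §2.5.3 Cor. 2.5.17 (PDF p. 135)] [cite: VoisinHodgeI2002, §7.1.2 (PDF p. 134 L31)] -/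
theorem IsPolarizationType.succ_dvd_relIndex_map_wedge_integralForms_two_of_eq_content_smul (hd : IsPolarizationType Φ η d)
    (hη : IsRiemannForm Φ η) (hle : j ≤ j + 2) {γ : E [⋀^Fin (2 * j)]→L[ℝ] ℂ}
    (hγ : wedgePow (ofRealForm η) j = ((j.factorial * ∏ i : Fin j, d (Fin.castLE hle i) : ℕ) : ℂ) • γ) :
    j + 1 ∣ ((integralForms Φ 2).map (AddMonoidHom.mk' (fun x : E [⋀^Fin 2]→L[ℝ] ℂ ↦ γ.wedge x)
        (ContinuousAlternatingMap.wedge_add_right _))).relIndex (integralForms Φ (2 * j + 2)) := by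
  obtain ⟨Φ', hΛ, hs⟩ := hd.exists_isSymplecticEnum Φ
  rw [integralForms_eq_of_range_latticeVec_eq hΛ.symm 2, integralForms_eq_of_range_latticeVec_eq hΛ.symm (2 * j + 2)]
  exact hs.succ_dvd_relIndex_map_wedge_integralForms_two_of_eq_content_smul Φ' (hη.of_range_latticeVec_subset hΛ.le) hle hγ

/-- **Any presentation, `g ≥ 3`: `γ_{g−2} ∧ H²(X, ℤ) ≠ H^{2g−2}(X, ℤ)`** — hard Lefschetz in degree two fails over `ℤ` even for the minimal class
(`g = j + 2`, `j ≥ 1`). [cite: Lange2023AbelianVarietiesComplex, §5.4.1 (5.22) (PDF p. 275)] [cite: VoisinHodgeI2002, §7.1.2 (PDF p. 134 L31)] -/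
theorem IsPolarizationType.not_integralForms_le_map_wedge_integralForms_two_of_eq_content_smul (hd : IsPolarizationType Φ η d)
    (hη : IsRiemannForm Φ η) (hj : 1 ≤ j) (hle : j ≤ j + 2) {γ : E [⋀^Fin (2 * j)]→L[ℝ] ℂ}
    (hγ : wedgePow (ofRealForm η) j = ((j.factorial * ∏ i : Fin j, d (Fin.castLE hle i) : ℕ) : ℂ) • γ) :
    ¬ integralForms Φ (2 * j + 2) ≤ (integralForms Φ 2).map (AddMonoidHom.mk' (fun x : E [⋀^Fin 2]→L[ℝ] ℂ ↦ γ.wedge x)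
        (ContinuousAlternatingMap.wedge_add_right _)) := by
  obtain ⟨Φ', hΛ, hs⟩ := hd.exists_isSymplecticEnum Φ
  rw [integralForms_eq_of_range_latticeVec_eq hΛ.symm 2, integralForms_eq_of_range_latticeVec_eq hΛ.symm (2 * j + 2)]
  exact hs.not_integralForms_le_map_wedge_integralForms_two_of_eq_content_smul Φ' (hη.of_range_latticeVec_subset hΛ.le) hj hle hγ

/-- **Any presentation: the order of `γ_{g−1}` modulo `γ_{g−2} ∧ H²(X, ℤ)` is `(g−1)·d_{g−1}/d₁`**, as the index
`[γ_{g−2} ∧ H² + ℤγ_{g−1} : γ_{g−2} ∧ H²] = (g−1)·d_{g−1}/d₁` (`g = j + 2`). [cite: Lange2023AbelianVarietiesComplex, §4.2 (PDF p. 204); §5.4.1 (5.22) (PDF p. 275); §1.5.1 (PDF p. 51)] [cite: BenoistDebarre2023SmoothSubvarietiesJacobians, §1 (p. 3)] -/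
theorem IsPolarizationType.relIndex_map_wedge_integralForms_two_sup_zmultiples_of_eq_content_smul (hd : IsPolarizationType Φ η d)
    (hη : IsRiemannForm Φ η) (hle : j ≤ j + 2) {γ : E [⋀^Fin (2 * j)]→L[ℝ] ℂ}
    (hγ : wedgePow (ofRealForm η) j = ((j.factorial * ∏ i : Fin j, d (Fin.castLE hle i) : ℕ) : ℂ) • γ)
    (hle₁ : j + 1 ≤ j + 2) {m : E [⋀^Fin (2 * j + 2)]→L[ℝ] ℂ}
    (hm : wedgePow (ofRealForm η) (j + 1) = (((j + 1).factorial * ∏ i : Fin (j + 1), d (Fin.castLE hle₁ i) : ℕ) : ℂ) • m) :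
    ((integralForms Φ 2).map (AddMonoidHom.mk' (fun x : E [⋀^Fin 2]→L[ℝ] ℂ ↦ γ.wedge x)
        (ContinuousAlternatingMap.wedge_add_right _))).relIndex
      ((integralForms Φ 2).map (AddMonoidHom.mk' (fun x : E [⋀^Fin 2]→L[ℝ] ℂ ↦ γ.wedge x)
        (ContinuousAlternatingMap.wedge_add_right _)) ⊔ AddSubgroup.zmultiples m) =
      (j + 1) * (d (Fin.last j).castSucc / d 0) := by
  obtain ⟨Φ', hΛ, hs⟩ := hd.exists_isSymplecticEnum Φ
  rw [integralForms_eq_of_range_latticeVec_eq hΛ.symm 2]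
  exact hs.relIndex_map_wedge_integralForms_two_sup_zmultiples_of_eq_content_smul Φ' (hη.of_range_latticeVec_subset hΛ.le) hle hγ hle₁ hm

/-- **Any presentation, `g = 2` or a constant type: `γ_{g−2} ∧ H²(X, ℤ) + ℤ·γ_{g−1} = H^{2g−2}(X, ℤ)`** (`g = j + 2`).
[cite: Lange2023AbelianVarietiesComplex, §4.2 (PDF p. 204); §5.4.1 (5.22) (PDF p. 275); §2.1.1] [cite: BenoistDebarre2023SmoothSubvarietiesJacobians, §1 (p. 3)] -/
theorem IsPolarizationType.map_wedge_integralForms_two_sup_zmultiples_eq_integralForms_of_eq_content_smul (hd : IsPolarizationType Φ η d)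
    (hη : IsRiemannForm Φ η) (hle : j ≤ j + 2) {γ : E [⋀^Fin (2 * j)]→L[ℝ] ℂ}
    (hγ : wedgePow (ofRealForm η) j = ((j.factorial * ∏ i : Fin j, d (Fin.castLE hle i) : ℕ) : ℂ) • γ)
    (hle₁ : j + 1 ≤ j + 2) {m : E [⋀^Fin (2 * j + 2)]→L[ℝ] ℂ}
    (hm : wedgePow (ofRealForm η) (j + 1) = (((j + 1).factorial * ∏ i : Fin (j + 1), d (Fin.castLE hle₁ i) : ℕ) : ℂ) • m)
    (hd₀ : j = 0 ∨ ∀ i, d i = d 0) :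
    (integralForms Φ 2).map (AddMonoidHom.mk' (fun x : E [⋀^Fin 2]→L[ℝ] ℂ ↦ γ.wedge x)
        (ContinuousAlternatingMap.wedge_add_right _)) ⊔ AddSubgroup.zmultiples m = integralForms Φ (2 * j + 2) := by
  obtain ⟨Φ', hΛ, hs⟩ := hd.exists_isSymplecticEnum Φ
  rw [integralForms_eq_of_range_latticeVec_eq hΛ.symm 2, integralForms_eq_of_range_latticeVec_eq hΛ.symm (2 * j + 2)]
  exact hs.map_wedge_integralForms_two_sup_zmultiples_eq_integralForms_of_eq_content_smul Φ' (hη.of_range_latticeVec_subset hΛ.le)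
    hle hγ hle₁ hm hd₀

/-- **Any presentation, constant type, `p` prime, `p ∣ g − 1`: `[K_p : p·H²(X, ℤ)] = p`** for the mod-`p` kernel
`K_p = {x ∈ H²(X, ℤ) : γ_{g−2} ∧ x ∈ p·H^{2g−2}(X, ℤ)}` (`g = j + 2`) — the kernel of the minimal class `∪ (−)` on `H²(X, ℤ/p)` is ONE line.
[cite: Lange2023AbelianVarietiesComplex, §5.4.1 Thm. 5.4.1 and (5.22) (PDF p. 275); §2.5.3 Cor. 2.5.17 (PDF p. 135); §2.1.1] [cite: VoisinHodgeI2002, §6.2.3 Thm. 6.25 (PDF p. 125); §7.1.2 (PDF p. 134 L31)] -/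
theorem IsPolarizationType.relIndex_map_nsmul_inf_comap_of_forall_eq (hd : IsPolarizationType Φ η d)
    (hη : IsRiemannForm Φ η) (hle : j ≤ j + 2) {γ : E [⋀^Fin (2 * j)]→L[ℝ] ℂ}
    (hγ : wedgePow (ofRealForm η) j = ((j.factorial * ∏ i : Fin j, d (Fin.castLE hle i) : ℕ) : ℂ) • γ) (hd₀ : ∀ i, d i = d 0)
    {p : ℕ} (hp : p.Prime) (hpj : p ∣ j + 1) :
    ((integralForms Φ 2).map (nsmulAddMonoidHom p)).relIndex
      (integralForms Φ 2 ⊓ ((integralForms Φ (2 * j + 2)).map (nsmulAddMonoidHom p)).comap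
        (AddMonoidHom.mk' (fun x : E [⋀^Fin 2]→L[ℝ] ℂ ↦ γ.wedge x) (ContinuousAlternatingMap.wedge_add_right _))) = p := by
  obtain ⟨Φ', hΛ, hs⟩ := hd.exists_isSymplecticEnum Φ
  rw [integralForms_eq_of_range_latticeVec_eq hΛ.symm 2, integralForms_eq_of_range_latticeVec_eq hΛ.symm (2 * j + 2)]
  exact hs.relIndex_map_nsmul_inf_comap_of_forall_eq Φ' (hη.of_range_latticeVec_subset hΛ.le) hle hγ hd₀ hp hpj

/-- **Any presentation, constant type, `p ∣ g − 1`: the mod-`p` kernel is NOT trivial**, `K_p ≠ p·H²(X, ℤ)` (`g = j + 2`).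
[cite: Lange2023AbelianVarietiesComplex, §5.4.1 (5.22) (PDF p. 275); §2.1.1] [cite: VoisinHodgeI2002, §7.1.2 (PDF p. 134 L31)] -/
theorem IsPolarizationType.inf_comap_map_nsmul_ne_map_nsmul_of_forall_eq (hd : IsPolarizationType Φ η d)
    (hη : IsRiemannForm Φ η) (hle : j ≤ j + 2) {γ : E [⋀^Fin (2 * j)]→L[ℝ] ℂ}
    (hγ : wedgePow (ofRealForm η) j = ((j.factorial * ∏ i : Fin j, d (Fin.castLE hle i) : ℕ) : ℂ) • γ) (hd₀ : ∀ i, d i = d 0)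
    {p : ℕ} (hp : p.Prime) (hpj : p ∣ j + 1) :
    integralForms Φ 2 ⊓ ((integralForms Φ (2 * j + 2)).map (nsmulAddMonoidHom p)).comap
        (AddMonoidHom.mk' (fun x : E [⋀^Fin 2]→L[ℝ] ℂ ↦ γ.wedge x) (ContinuousAlternatingMap.wedge_add_right _)) ≠
      (integralForms Φ 2).map (nsmulAddMonoidHom p) := by
  obtain ⟨Φ', hΛ, hs⟩ := hd.exists_isSymplecticEnum Φ
  rw [integralForms_eq_of_range_latticeVec_eq hΛ.symm 2, integralForms_eq_of_range_latticeVec_eq hΛ.symm (2 * j + 2)]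
  exact hs.inf_comap_map_nsmul_ne_map_nsmul_of_forall_eq Φ' (hη.of_range_latticeVec_subset hΛ.le) hle hγ hd₀ hp hpj

/-- **Any presentation, constant type, `p ∣ g − 1`: `γ_{g−2} ∧ x ∈ p·H^{2g−2}(X, ℤ) ⟺ x ∈ ℤ·(θ/d₁) + p·H²(X, ℤ)`** for integral `x`
(`g = j + 2`; `θ/d₁ = γ₁` the primitive polarisation class). [cite: Lange2023AbelianVarietiesComplex, §5.4.1 Thm. 5.4.1 and (5.22) (PDF p. 275); §2.5.3 Cor. 2.5.17 (PDF p. 135); §2.1.1] [cite: VoisinHodgeI2002, §6.2.3 Thm. 6.25 (PDF p. 125); §7.1.2 (PDF p. 134 L31)] -/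
theorem IsPolarizationType.wedge_mem_map_nsmul_iff_of_forall_eq (hd : IsPolarizationType Φ η d)
    (hη : IsRiemannForm Φ η) (hle : j ≤ j + 2) {γ : E [⋀^Fin (2 * j)]→L[ℝ] ℂ}
    (hγ : wedgePow (ofRealForm η) j = ((j.factorial * ∏ i : Fin j, d (Fin.castLE hle i) : ℕ) : ℂ) • γ) (hd₀ : ∀ i, d i = d 0)
    {p : ℕ} (hp : p.Prime) (hpj : p ∣ j + 1) {x : E [⋀^Fin 2]→L[ℝ] ℂ} (hx : x ∈ integralForms Φ 2) :
    γ.wedge x ∈ (integralForms Φ (2 * j + 2)).map (nsmulAddMonoidHom p) ↔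
      ∃ (k : ℤ) (y : E [⋀^Fin 2]→L[ℝ] ℂ), y ∈ integralForms Φ 2 ∧ x = k • ((((d 0 : ℕ) : ℂ))⁻¹ • ofRealForm η) + p • y := by
  obtain ⟨Φ', hΛ, hs⟩ := hd.exists_isSymplecticEnum Φ
  rw [integralForms_eq_of_range_latticeVec_eq hΛ.symm 2] at hx ⊢
  rw [integralForms_eq_of_range_latticeVec_eq hΛ.symm (2 * j + 2)]
  exact hs.wedge_mem_map_nsmul_iff_of_forall_eq Φ' (hη.of_range_latticeVec_subset hΛ.le) hle hγ hd₀ hp hpj hx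

end DegreeTwo

/-! ## §3 The `H³` side of `γ_{g−2}`: `γ_{g−2} ∧ H³(X, ℤ) ⊆ H^{2g−1}(X, ℤ)` (`g = j + 2`) -/

section DegreeThreeSide

variable {ι : Type*} [Fintype ι] [DecidableEq ι] {E : Type*} [NormedAddCommGroup E] [NormedSpace ℂ E]
  {Φ : (ι → ℝ) ≃L[ℝ] E} {j : ℕ} {η : E [⋀^Fin 2]→L[ℝ] ℝ} {d : Fin (j + 2) → ℕ}

/-- **Any presentation: `[H^{2g−1}(X, ℤ) : γ_{g−2} ∧ H³(X, ℤ)] = ∏_x d_{g−1}/d_{min(a(x), g−1)}`** (`g = j + 2`).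
[cite: Lange2023AbelianVarietiesComplex, §5.4.1 Thm. 5.4.1 and (5.22) (PDF p. 275); §1.5.1 (PDF p. 51)] [cite: VoisinHodgeI2002, §7.1.2 (PDF p. 134 L31)] -/
theorem IsPolarizationType.relIndex_map_wedge_integralForms_three_of_eq_content_smul (hd : IsPolarizationType Φ η d)
    (hη : IsRiemannForm Φ η) (hle₂ : j ≤ j + 2) {γ : E [⋀^Fin (2 * j)]→L[ℝ] ℂ}
    (hγ : wedgePow (ofRealForm η) j = ((j.factorial * ∏ i : Fin j, d (Fin.castLE hle₂ i) : ℕ) : ℂ) • γ) :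
    ((integralForms Φ 3).map (AddMonoidHom.mk'
        (fun x : E [⋀^Fin 3]→L[ℝ] ℂ ↦ γ.wedge x) (ContinuousAlternatingMap.wedge_add_right _))).relIndex (integralForms Φ (2 * j + 3)) =
      ∏ x : Fin (j + 2) ⊕ Fin (j + 2), (d ((Fin.last j).castSucc) /
        d (if Sum.elim id id x = Fin.last (j + 1) then ((Fin.last j).castSucc : Fin (j + 2)) else Sum.elim id id x)) := by
  obtain ⟨Φ', hΛ, hs⟩ := hd.exists_isSymplecticEnum Φ
  rw [integralForms_eq_of_range_latticeVec_eq hΛ.symm 3, integralForms_eq_of_range_latticeVec_eq hΛ.symm (2 * j + 3)]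
  exact hs.relIndex_map_wedge_integralForms_three_of_eq_content_smul Φ' (hη.of_range_latticeVec_subset hΛ.le) hle₂ hγ

/-- **Any presentation: `(d_{g−1}/d₁)·y ∈ γ_{g−2} ∧ H³(X, ℤ)` for every `y ∈ H^{2g−1}(X, ℤ)`** (`g = j + 2`).
[cite: Lange2023AbelianVarietiesComplex, §5.4.1 (5.22) (PDF p. 275); §1.5.1 (PDF p. 51)] [cite: VoisinHodgeI2002, §7.1.2 (PDF p. 134 L31)] -/
theorem IsPolarizationType.nsmul_mem_map_wedge_integralForms_three_of_eq_content_smul (hd : IsPolarizationType Φ η d)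
    (hη : IsRiemannForm Φ η) (hle₂ : j ≤ j + 2) {γ : E [⋀^Fin (2 * j)]→L[ℝ] ℂ}
    (hγ : wedgePow (ofRealForm η) j = ((j.factorial * ∏ i : Fin j, d (Fin.castLE hle₂ i) : ℕ) : ℂ) • γ)
    {y : E [⋀^Fin (2 * j + 3)]→L[ℝ] ℂ} (hy : y ∈ integralForms Φ (2 * j + 3)) :
    (d (Fin.last j).castSucc / d 0) • y ∈ (integralForms Φ 3).map (AddMonoidHom.mk'
        (fun x : E [⋀^Fin 3]→L[ℝ] ℂ ↦ γ.wedge x) (ContinuousAlternatingMap.wedge_add_right _)) := by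
  obtain ⟨Φ', hΛ, hs⟩ := hd.exists_isSymplecticEnum Φ
  rw [integralForms_eq_of_range_latticeVec_eq hΛ.symm (2 * j + 3)] at hy
  rw [integralForms_eq_of_range_latticeVec_eq hΛ.symm 3]
  exact hs.nsmul_mem_map_wedge_integralForms_three_of_eq_content_smul Φ' (hη.of_range_latticeVec_subset hΛ.le) hle₂ hγ hy

/-- **Any presentation, `p` prime: `γ_{g−2} ∧ H³(X, ℤ) + p·H^{2g−1}(X, ℤ) = H^{2g−1}(X, ℤ) ⟺ p ∤ d_{g−1}/d₁`** (`g = j + 2`).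
[cite: Lange2023AbelianVarietiesComplex, §5.4.1 (5.22) (PDF p. 275); §1.5.1 (PDF p. 51)] [cite: VoisinHodgeI2002, §7.1.2 (PDF p. 134 L31)] -/
theorem IsPolarizationType.map_wedge_integralForms_three_sup_map_nsmul_eq_iff_not_dvd_of_eq_content_smul
    (hd : IsPolarizationType Φ η d) (hη : IsRiemannForm Φ η) (hle₂ : j ≤ j + 2) {γ : E [⋀^Fin (2 * j)]→L[ℝ] ℂ}
    (hγ : wedgePow (ofRealForm η) j = ((j.factorial * ∏ i : Fin j, d (Fin.castLE hle₂ i) : ℕ) : ℂ) • γ) {p : ℕ} (hp : p.Prime) :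
    (integralForms Φ 3).map (AddMonoidHom.mk'
        (fun x : E [⋀^Fin 3]→L[ℝ] ℂ ↦ γ.wedge x) (ContinuousAlternatingMap.wedge_add_right _)) ⊔
      (integralForms Φ (2 * j + 3)).map (nsmulAddMonoidHom p) = integralForms Φ (2 * j + 3) ↔
      ¬p ∣ d (Fin.last j).castSucc / d 0 := by
  obtain ⟨Φ', hΛ, hs⟩ := hd.exists_isSymplecticEnum Φ
  rw [integralForms_eq_of_range_latticeVec_eq hΛ.symm 3, integralForms_eq_of_range_latticeVec_eq hΛ.symm (2 * j + 3)]
  exact hs.map_wedge_integralForms_three_sup_map_nsmul_eq_iff_not_dvd_of_eq_content_smul Φ' (hη.of_range_latticeVec_subset hΛ.le)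
    hle₂ hγ hp

end DegreeThreeSide

/-! ## §4 Degree three: `γ_{g−3} ∧ H³(X, ℤ) ⊆ H^{2g−3}(X, ℤ)` (`g = j + 3`) -/

section DegreeThree

variable {ι : Type*} [Fintype ι] [DecidableEq ι] {E : Type*} [NormedAddCommGroup E] [NormedSpace ℂ E]
  {Φ : (ι → ℝ) ≃L[ℝ] E} {j : ℕ} {η : E [⋀^Fin 2]→L[ℝ] ℝ} {d : Fin (j + 3) → ℕ}

/-- **Any presentation: `(g−2)^{2g} ∣ [H^{2g−3}(X, ℤ) : γ_{g−3} ∧ H³(X, ℤ)]`** (`g = j + 3`).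
[cite: Lange2023AbelianVarietiesComplex, §5.4.1 Thm. 5.4.1 and (5.22) (PDF p. 275); §2.5.3 Cor. 2.5.17 (PDF p. 135)] [cite: VoisinHodgeI2002, §7.1.2 (PDF p. 134 L31)] -/
theorem IsPolarizationType.pow_dvd_relIndex_map_wedge_integralForms_three_hardLefschetz_of_eq_content_smul
    (hd : IsPolarizationType Φ η d) (hη : IsRiemannForm Φ η) (hle : j ≤ j + 3) {γ : E [⋀^Fin (2 * j)]→L[ℝ] ℂ}
    (hγ : wedgePow (ofRealForm η) j = ((j.factorial * ∏ i : Fin j, d (Fin.castLE hle i) : ℕ) : ℂ) • γ) :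
    (j + 1) ^ (2 * (j + 3)) ∣ ((integralForms Φ 3).map (AddMonoidHom.mk' (fun x : E [⋀^Fin 3]→L[ℝ] ℂ ↦ γ.wedge x)
        (ContinuousAlternatingMap.wedge_add_right _))).relIndex (integralForms Φ (2 * j + 3)) := by
  obtain ⟨Φ', hΛ, hs⟩ := hd.exists_isSymplecticEnum Φ
  rw [integralForms_eq_of_range_latticeVec_eq hΛ.symm 3, integralForms_eq_of_range_latticeVec_eq hΛ.symm (2 * j + 3)]
  exact hs.pow_dvd_relIndex_map_wedge_integralForms_three_hardLefschetz_of_eq_content_smul Φ' (hη.of_range_latticeVec_subset hΛ.le) hle hγ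

/-- **Any presentation, `g ≥ 4`: `γ_{g−3} ∧ H³(X, ℤ) ≠ H^{2g−3}(X, ℤ)`** (`g = j + 3`, `j ≥ 1`).
[cite: Lange2023AbelianVarietiesComplex, §5.4.1 (5.22) (PDF p. 275)] [cite: VoisinHodgeI2002, §7.1.2 (PDF p. 134 L31)] -/
theorem IsPolarizationType.not_integralForms_le_map_wedge_integralForms_three_hardLefschetz_of_eq_content_smul
    (hd : IsPolarizationType Φ η d) (hη : IsRiemannForm Φ η) (hj : 1 ≤ j) (hle : j ≤ j + 3) {γ : E [⋀^Fin (2 * j)]→L[ℝ] ℂ}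
    (hγ : wedgePow (ofRealForm η) j = ((j.factorial * ∏ i : Fin j, d (Fin.castLE hle i) : ℕ) : ℂ) • γ) :
    ¬ integralForms Φ (2 * j + 3) ≤ (integralForms Φ 3).map (AddMonoidHom.mk' (fun x : E [⋀^Fin 3]→L[ℝ] ℂ ↦ γ.wedge x)
        (ContinuousAlternatingMap.wedge_add_right _)) := by
  obtain ⟨Φ', hΛ, hs⟩ := hd.exists_isSymplecticEnum Φ
  rw [integralForms_eq_of_range_latticeVec_eq hΛ.symm 3, integralForms_eq_of_range_latticeVec_eq hΛ.symm (2 * j + 3)]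
  exact hs.not_integralForms_le_map_wedge_integralForms_three_hardLefschetz_of_eq_content_smul Φ' (hη.of_range_latticeVec_subset hΛ.le)
    hj hle hγ

end DegreeThree

end Literature.Geometry.Kaehler.ComplexTorus
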